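import Summits.ResolutionOfSingularities.ResolutionOfSingularities.Theorems.DeltaCutChain2
import HarnessLib

/-!
# DeltaCutChain3 — decomp-res node «ChainCut» (lens-6 g24, critic row 185 CLEARED DECIDED +1 · MAP 0), tree file 3/5 of the node

Content VERBATIM from the decomp-res lens-6 g24 node `HOME/decomp-res-lens-6/g24/ChainCut.lean` (pin dd25c369;
imports the landed tree only, carries nothing); HOME = run/shared/lean/pub/decomp-res; critic row 185 CLEARED
DECIDED +1 · MAP 0; landing orders INBOX :962/:964/:980 — provenance, critic text and the lens header in full in the
first file of the node, `DeltaCutChain`.  Namespace `…Theorems.DeltaCutClasses`; `--supports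
stmt-ResolutionOfSingularities-26971`.

## This file

Continuation 3/3 of `DeltaCutChain` (same sections of the node, cut at the 400-line cap): carries
`worTopChainHeavy_iff_badInfinite_finiteChainHeavy`, `e1TopChainHeavy_iff_badInfinite_finiteChainHeavy`,
`noNearPointOver_transform_iff_deltaLightAt`, `not_chainLightAt_iff_exists_wild_near_chain`, `mem_badSet_iff`,
`badSet_eq_nearSet`, `topChainHeavy_iff_exists`, `topBadInfinite_iff_infinite`, `topFiniteChainHeavy_iff_exists`.

[WRITER NOTE (decomp-res writer g12): file split only (tree files ≤ 400 lines); namespace, sections, section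
variables / opens and every declaration exactly as in the lens (the node's global dupNamespace-linter line is
dropped — the library sets it).]

(Sources: Hironaka1967 (characteristic polyhedra); CossartJannsenSaito2020 Def. 3.13 / Thm. 3.14, Ch. 8, Thm. 9.6;
Hironaka1970 (near points / vertices); CossartPiltant2019 Prop. 2.6 (δ at chart origins); CossartPiltant2008 §2;
Giraud1975; Hironaka2005 (three key theorems: order under permissible blow-up); EGAIV4 §16–§17; StacksProject 0804 /
0BIQ / 031I; Matsumura1987 §28.)
-/

noncomputable section

open CategoryTheory CategoryTheory.Limits AlgebraicGeometry TopologicalSpace IsLocalRing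
open Literature.AlgebraicGeometry.Resolution

universe u

namespace Summit.ResolutionOfSingularities.ResolutionOfSingularities.Theorems.DeltaCutClasses

open Summit.ResolutionOfSingularities.ResolutionOfSingularities.Theorems.TwistCutClasses
open Summit.ResolutionOfSingularities.ResolutionOfSingularities.Theorems.LightCutClasses

section ChainSubCells

open Summit.ResolutionOfSingularities.ResolutionOfSingularities.Theorems
open WeakOrderReduction ForcedTowerClasses SubfieldContactClasses AbsoluteContactClasses PurityValveClasses

/-- **EXACT SPLIT of the residual cell by letter** (hypothesis-free): `WORTopChainHeavy n ⟺ WORTopBadInfinite n ∧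
WORTopFiniteChainHeavy n`.
[new] [folklore] -/
theorem worTopChainHeavy_iff_badInfinite_finiteChainHeavy (n : ℕ) :
    WORTopChainHeavy n ↔ WORTopBadInfinite n ∧ WORTopFiniteChainHeavy n := by
  constructor
  · intro h
    exact ⟨fun p hp k _ _ Y g hB M hM hT hD hC _ => h p hp k Y g hB M hM hT hD hC,
      fun p hp k _ _ Y g hB M hM hT hD hC _ => h p hp k Y g hB M hM hT hD hC⟩
  · rintro ⟨hR, hI⟩ p hp k _ _ Y g hB M hM hT hD hC
    by_cases hc : TopBadInfinite Y M.ideal n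
    · exact hR p hp k Y g hB M hM hT hD hC hc
    · exact hI p hp k Y g hB M hM hT hD hC hc

/-- Family version. [new] [folklore] -/
theorem e1TopChainHeavy_iff_badInfinite_finiteChainHeavy :
    E1TopChainHeavy ↔ E1TopBadInfinite ∧ E1TopFiniteChainHeavy :=
  ⟨fun h => ⟨fun n hn => ((worTopChainHeavy_iff_badInfinite_finiteChainHeavy n).1 (h n hn)).1,
      fun n hn => ((worTopChainHeavy_iff_badInfinite_finiteChainHeavy n).1 (h n hn)).2⟩,
    fun h n hn => (worTopChainHeavy_iff_badInfinite_finiteChainHeavy n).2 ⟨h.1 n hn, h.2 n hn⟩⟩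

end ChainSubCells

section ChainExactness

open Summit.ResolutionOfSingularities.ResolutionOfSingularities.Theorems
open WeakOrderReduction ForcedTowerClasses SubfieldContactClasses AbsoluteContactClasses PurityValveClasses

/-! ### EXACTNESS of the chain letter and of the residual locus: «a δ-heavy WILD near-point CHAIN OF LENGTH 2» -/

/-- (N) UPSTAIRS: over base data, at a closed point of ANY blow-up along a regular centre, `NoNearPointOver ⟺
DeltaLightAt` for the
transformed datum (the blown-up scheme is regular, locally Noetherian, and its stalks have characteristic `p` via `π
≫ g`). [new] [folklore] -/
theorem noNearPointOver_transform_iff_deltaLightAt {p : ℕ} (hp : p.Prime) {k : Type} [Field k] [CharP k p]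
    {Y : Scheme.{0}} {g : Y ⟶ Spec (.of k)} (hB : IsBase Y g) {n : ℕ} (hn : 1 ≤ n) {M : MarkedIdeal Y} (hM : IsDatum n M)
    {C : Y.IdealSheafData} (hCreg : Scheme.IsRegular C.subscheme) {Y' : Scheme.{0}} {π : Y' ⟶ Y} (hπ : IsBlowup π C)
    {y' : Y'} (hyc : IsClosed ({y'} : Set Y')) (hord : idealOrder (M.transform π C).ideal y' = ((n : ℕ) : ℕ∞)) :
    NoNearPointOver (M.transform π C) y' ↔ DeltaLightAt (M.transform π C).ideal n y' := by
  haveI : Fact p.Prime := ⟨hp⟩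
  haveI := hB.locallyOfFiniteType
  haveI : IsLocallyNoetherian Y := LocallyOfFiniteType.isLocallyNoetherian g
  haveI : IsLocallyNoetherian Y' := hπ.isLocallyNoetherian
  have hY' : Scheme.IsRegular Y' := hπ.isRegular_of_isRegular_subscheme hB.isRegular hCreg
  letI := stalkAlgebra ((π ≫ g).appTop.hom.comp (Scheme.ΓSpecIso (.of k)).inv.hom) y'
  haveI : CharP (Y'.presheaf.stalk y') p := charP_of_injective_algebraMap (algebraMap k (Y'.presheaf.stalk y')).injective p
  exact noNearPointOver_iff_deltaLightAt hY' hn _ (by rw [MarkedIdeal.transform_mult, hM.1]) hyc hord.ge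

/-- **EXACTNESS OF THE CHAIN LETTER**: over base data, `¬ ChainLightAt 𝓘 n y` iff there are a blow-up `π` along a regular centre
supported exactly at `y` and a WILD closed top point `y'` OVER `y` of the transform which HAS ITSELF A NEAR POINT
(`¬ NoNearPointOver`, by (N) upstairs) — a δ-heavy wild near-point CHAIN OF LENGTH 2, `y ← y' ← y''`. [new] [folklore] -/
theorem not_chainLightAt_iff_exists_wild_near_chain {p : ℕ} (hp : p.Prime) {k : Type} [Field k] [CharP k p]
    {Y : Scheme.{0}} {g : Y ⟶ Spec (.of k)} (hB : IsBase Y g) {n : ℕ} (hn : 1 ≤ n) {M : MarkedIdeal Y} (hM : IsDatum n M)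
    (y : Y) :
    ¬ ChainLightAt M.ideal n y ↔ ∃ (C : Y.IdealSheafData) (Y' : Scheme.{0}) (π : Y' ⟶ Y),
      (C.support : Set Y) = {y} ∧ Scheme.IsRegular C.subscheme ∧ IsBlowup π C ∧
        ∃ y' : Y', π.base y' = y ∧ y' ∈ wildSet (M.transform π C) n ∧ ¬ NoNearPointOver (M.transform π C) y' := by
  constructor
  · intro h
    unfold ChainLightAt at h
    push Not at h
    obtain ⟨C, Y', π, hCsupp, hCreg, hπ, y', hy', hyc, hord, hna, hnd⟩ := h
    have hord' : idealOrder (M.transform π C).ideal y' = ((n : ℕ) : ℕ∞) := by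
      rw [MarkedIdeal.transform_ideal, hM.1]; exact hord
    refine ⟨C, Y', π, hCsupp, hCreg, hπ, y', hy', ⟨hyc, hord', ?_⟩, fun hno => hnd ?_⟩
    · rw [MarkedIdeal.transform_ideal, hM.1]; exact hna
    · have h1 := (noNearPointOver_transform_iff_deltaLightAt hp hB hn hM hCreg hπ hyc hord').1 hno
      rw [MarkedIdeal.transform_ideal, hM.1] at h1
      exact h1
  · rintro ⟨C, Y', π, hCsupp, hCreg, hπ, y', hy', ⟨hyc, hord, hna⟩, hno⟩ h
    apply hno
    rw [noNearPointOver_transform_iff_deltaLightAt hp hB hn hM hCreg hπ hyc hord, MarkedIdeal.transform_ideal, hM.1]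
    rw [MarkedIdeal.transform_ideal, hM.1] at hord hna
    exact h C Y' π hCsupp hCreg hπ y' hy' hyc hord hna

/-- **THE BAD SET = WILD POINTS WITH A NEAR POINT** (by (N)). [new] [folklore] -/
theorem mem_badSet_iff {p : ℕ} (hp : p.Prime) {k : Type} [Field k] [CharP k p] {Y : Scheme.{0}} {g : Y ⟶ Spec (.of k)}
    (hB : IsBase Y g) {n : ℕ} (hn : 1 ≤ n) {M : MarkedIdeal Y} (hM : IsDatum n M) (y : Y) :
    y ∈ badSet M n ↔ y ∈ wildSet M n ∧ ¬ NoNearPointOver M y := by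
  haveI : Fact p.Prime := ⟨hp⟩
  haveI := hB.locallyOfFiniteType
  haveI : IsLocallyNoetherian Y := LocallyOfFiniteType.isLocallyNoetherian g
  refine and_congr_right fun hw => not_congr ?_
  letI := stalkAlgebra (g.appTop.hom.comp (Scheme.ΓSpecIso (.of k)).inv.hom) y
  haveI : CharP (Y.presheaf.stalk y) p := charP_of_injective_algebraMap (algebraMap k (Y.presheaf.stalk y)).injective p
  exact (noNearPointOver_iff_deltaLightAt hB.isRegular hn M hM.1 hw.1 hw.2.1.ge).symm

/-- **THE BAD SET = THE WILD POINTS WITH A NEAR POINT**, as sets (by (N)). [new] [folklore] -/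
theorem badSet_eq_nearSet {p : ℕ} (hp : p.Prime) {k : Type} [Field k] [CharP k p] {Y : Scheme.{0}} {g : Y ⟶ Spec (.of k)}
    (hB : IsBase Y g) {n : ℕ} (hn : 1 ≤ n) {M : MarkedIdeal Y} (hM : IsDatum n M) :
    badSet M n = {y | y ∈ wildSet M n ∧ ¬ NoNearPointOver M y} :=
  Set.ext fun y => mem_badSet_iff hp hB hn hM y

/-- **EXACTNESS OF THE LOCATED RESIDUAL LOCUS**: over base data, `TopChainHeavy` iff the wild closed top points WITH
A NEAR POINT are
INFINITE in number OR one of them starts a δ-heavy WILD near-point chain of length `2`. [new] [folklore] -/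
theorem topChainHeavy_iff_exists {p : ℕ} (hp : p.Prime) {k : Type} [Field k] [CharP k p] {Y : Scheme.{0}}
    {g : Y ⟶ Spec (.of k)} (hB : IsBase Y g) {n : ℕ} (hn : 1 ≤ n) {M : MarkedIdeal Y} (hM : IsDatum n M) :
    TopChainHeavy Y M.ideal n ↔ {y | y ∈ wildSet M n ∧ ¬ NoNearPointOver M y}.Infinite ∨
      ∃ y ∈ wildSet M n, ¬ NoNearPointOver M y ∧ ∃ (C : Y.IdealSheafData) (Y' : Scheme.{0}) (π : Y' ⟶ Y),
        (C.support : Set Y) = {y} ∧ Scheme.IsRegular C.subscheme ∧ IsBlowup π C ∧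
          ∃ y' : Y', π.base y' = y ∧ y' ∈ wildSet (M.transform π C) n ∧ ¬ NoNearPointOver (M.transform π C) y' := by
  rw [TopChainHeavy, ← badSet_eq_badLocus, badSet_eq_nearSet hp hB hn hM]
  refine or_congr Iff.rfl ?_
  constructor
  · rintro ⟨y, ⟨hw, hnn⟩, hncl⟩
    exact ⟨y, hw, hnn, (not_chainLightAt_iff_exists_wild_near_chain hp hB hn hM y).1 hncl⟩
  · rintro ⟨y, hw, hnn, hch⟩
    exact ⟨y, ⟨hw, hnn⟩, (not_chainLightAt_iff_exists_wild_near_chain hp hB hn hM y).2 hch⟩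

/-- **EXACTNESS OF THE INFINITE kind**: infinitely many wild closed top points with a near point. [new] [folklore] -/
theorem topBadInfinite_iff_infinite {p : ℕ} (hp : p.Prime) {k : Type} [Field k] [CharP k p] {Y : Scheme.{0}}
    {g : Y ⟶ Spec (.of k)} (hB : IsBase Y g) {n : ℕ} (hn : 1 ≤ n) {M : MarkedIdeal Y} (hM : IsDatum n M) :
    TopBadInfinite Y M.ideal n ↔ {y | y ∈ wildSet M n ∧ ¬ NoNearPointOver M y}.Infinite := by
  rw [TopBadInfinite, ← badSet_eq_badLocus, badSet_eq_nearSet hp hB hn hM]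

/-- **EXACTNESS OF THE FINITE-CHAIN kind**: finitely many wild closed top points with a near point, one of which
starts a δ-heavy
WILD near-point chain of length `2`. [new] [folklore] -/
theorem topFiniteChainHeavy_iff_exists {p : ℕ} (hp : p.Prime) {k : Type} [Field k] [CharP k p] {Y : Scheme.{0}}
    {g : Y ⟶ Spec (.of k)} (hB : IsBase Y g) {n : ℕ} (hn : 1 ≤ n) {M : MarkedIdeal Y} (hM : IsDatum n M) :
    TopFiniteChainHeavy Y M.ideal n ↔ {y | y ∈ wildSet M n ∧ ¬ NoNearPointOver M y}.Finite ∧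
      ∃ y ∈ wildSet M n, ¬ NoNearPointOver M y ∧ ∃ (C : Y.IdealSheafData) (Y' : Scheme.{0}) (π : Y' ⟶ Y),
        (C.support : Set Y) = {y} ∧ Scheme.IsRegular C.subscheme ∧ IsBlowup π C ∧
          ∃ y' : Y', π.base y' = y ∧ y' ∈ wildSet (M.transform π C) n ∧ ¬ NoNearPointOver (M.transform π C) y' := by
  rw [TopFiniteChainHeavy, ← badSet_eq_badLocus, badSet_eq_nearSet hp hB hn hM]
  refine and_congr Iff.rfl ?_
  constructor
  · rintro ⟨y, ⟨hw, hnn⟩, hncl⟩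
    exact ⟨y, hw, hnn, (not_chainLightAt_iff_exists_wild_near_chain hp hB hn hM y).1 hncl⟩
  · rintro ⟨y, hw, hnn, hch⟩
    exact ⟨y, ⟨hw, hnn⟩, (not_chainLightAt_iff_exists_wild_near_chain hp hB hn hM y).2 hch⟩

end ChainExactness

end Summit.ResolutionOfSingularities.ResolutionOfSingularities.Theorems.DeltaCutClasses
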